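import Summits.HubbardSuperconductivity.HubbardSuperconductivity.Theorems.SoloBlindReciprocalBlocks
import HarnessLib

/-!
# Block data from dyadic windows (solo-blind programme, Theorem 28(f))

The finite combinatorics of the `U = 0` book-end (claim C53, item E6b(ii)): from a "Fermi set" `F`
in a finite type with `2#F ≤ card`, and two families of windows `W⁺_j` (disjoint from `F`) and
`W⁻_j ⊆ F` with `#W⁺_j = #W⁻_j`, each family pairwise disjoint, we build for every `J` the mode set
`A ⊇ F` with `A∖F = ⋃_{j≤J} W⁺_j ⊔ R`, `F = ⋃_{j≤J} W⁻_j ⊔ C`, `#R = #C`, `#(A∖F) = #F`, and a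
colouring `col` (`= j` on `W^±_j`, `j ≤ J`; `= J+1` on `R ∪ C`) whose fibres in `A∖F` and in `F`
have equal sizes (`exists_blocks`) — exactly the block data consumed by
`SoloBlindCooperTrial.trial_of_blocks` / `SoloBlindReciprocalBlocks.blocks_fugacity_window`.
Pure finite combinatorics. [this work]
-/

namespace Summit.HubbardSuperconductivity.HubbardSuperconductivity.Theorems.CooperBlocks

open Finset

variable {α : Type*} [DecidableEq α]

/-- The fibres of a colouring that is `j` on the pieces `W_j` (`j ≤ J`) and `J+1` on the remainder
`R` of `P = ⋃_{j≤J} W_j ∪ R`. -/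
theorem filter_col_eq_of_pieces (P R : Finset α) (W : ℕ → Finset α) (J : ℕ) (col : α → ℕ)
    (hP : P = (range (J + 1)).biUnion W ∪ R) (hcolW : ∀ j < J + 1, ∀ k ∈ W j, col k = j)
    (hcolR : ∀ k ∈ R, col k = J + 1) (c : ℕ) :
    P.filter (fun k => col k = c) = if c < J + 1 then W c else if c = J + 1 then R else ∅ := by
  ext k
  simp only [mem_filter, hP, mem_union, mem_biUnion, mem_range]
  split_ifs with h1 h2
  · constructor
    · rintro ⟨hk | hk, hc⟩
      · obtain ⟨j, hj, hkj⟩ := hk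
        have hj' : j = c := (hcolW j hj k hkj).symm.trans hc
        exact hj' ▸ hkj
      · have := hcolR k hk
        omega
    · intro hk
      exact ⟨Or.inl ⟨c, h1, hk⟩, hcolW c h1 k hk⟩
  · constructor
    · rintro ⟨hk | hk, hc⟩
      · obtain ⟨j, hj, hkj⟩ := hk
        have := hcolW j hj k hkj
        omega
      · exact hk
    · intro hk
      exact ⟨Or.inr hk, (hcolR k hk).trans h2.symm⟩
  · simp only [notMem_empty, iff_false, not_and]
    rintro (hk | hk) hc
    · obtain ⟨j, hj, hkj⟩ := hk
      have := hcolW j hj k hkj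
      omega
    · have := hcolR k hk
      omega

/-- Equal fibre sizes for two such decompositions with matching piece sizes. -/
theorem card_filter_col_eq_of_pieces (P Q R C : Finset α) (Wp Wm : ℕ → Finset α) (J : ℕ)
    (col : α → ℕ) (hP : P = (range (J + 1)).biUnion Wp ∪ R)
    (hQ : Q = (range (J + 1)).biUnion Wm ∪ C) (hcolWp : ∀ j < J + 1, ∀ k ∈ Wp j, col k = j)
    (hcolWm : ∀ j < J + 1, ∀ k ∈ Wm j, col k = j) (hcolR : ∀ k ∈ R, col k = J + 1)
    (hcolC : ∀ k ∈ C, col k = J + 1) (hW : ∀ j < J + 1, #(Wp j) = #(Wm j)) (hRC : #R = #C)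
    (c : ℕ) : #(P.filter fun k => col k = c) = #(Q.filter fun k => col k = c) := by
  rw [filter_col_eq_of_pieces P R Wp J col hP hcolWp hcolR c,
    filter_col_eq_of_pieces Q C Wm J col hQ hcolWm hcolC c]
  split_ifs with h1 h2
  · exact hW c h1
  · exact hRC
  · rfl

/-- A colouring by the window index (`J+1` off the first `J+1` windows). -/
theorem exists_col (F R : Finset α) (Wp Wm : ℕ → Finset α) (J : ℕ)
    (hWpF : ∀ j, Disjoint (Wp j) F) (hWmF : ∀ j, Wm j ⊆ F)
    (hdisjP : ∀ j j', j ≠ j' → Disjoint (Wp j) (Wp j'))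
    (hdisjM : ∀ j j', j ≠ j' → Disjoint (Wm j) (Wm j')) (hRF : Disjoint R F)
    (hRU : ∀ j < J + 1, Disjoint R (Wp j)) :
    ∃ col : α → ℕ, (∀ j < J + 1, ∀ k ∈ Wp j, col k = j) ∧ (∀ j < J + 1, ∀ k ∈ Wm j, col k = j) ∧
      (∀ k ∈ R, col k = J + 1) ∧ (∀ k ∈ F, (∀ j < J + 1, k ∉ Wm j) → col k = J + 1) := by
  classical
  obtain ⟨col, hcol⟩ : ∃ col : α → ℕ, ∀ k, col k =
      if h : ∃ j, k ∈ Wp j ∪ Wm j then min (Nat.find h) (J + 1) else J + 1 := ⟨_, fun _ => rfl⟩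
  -- the window index of a window element
  have findP : ∀ j, ∀ k ∈ Wp j, ∀ h : ∃ i, k ∈ Wp i ∪ Wm i, Nat.find h = j := by
    intro j k hk h
    have hs := Nat.find_spec h
    rcases mem_union.1 hs with h1 | h1
    · by_contra hne
      exact disjoint_left.1 (hdisjP _ _ hne) h1 hk
    · exact absurd (hWmF _ h1) (disjoint_left.1 (hWpF j) hk)
  have findM : ∀ j, ∀ k ∈ Wm j, ∀ h : ∃ i, k ∈ Wp i ∪ Wm i, Nat.find h = j := by
    intro j k hk h
    have hs := Nat.find_spec h
    rcases mem_union.1 hs with h1 | h1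
    · exact absurd (hWmF j hk) (disjoint_left.1 (hWpF _) h1)
    · by_contra hne
      exact disjoint_left.1 (hdisjM _ _ hne) h1 hk
  refine ⟨col, fun j hj k hk => ?_, fun j hj k hk => ?_, fun k hk => ?_, fun k hk hk' => ?_⟩
  · have h : ∃ i, k ∈ Wp i ∪ Wm i := ⟨j, mem_union_left _ hk⟩
    rw [hcol, dif_pos h, findP j k hk h]
    omega
  · have h : ∃ i, k ∈ Wp i ∪ Wm i := ⟨j, mem_union_right _ hk⟩
    rw [hcol, dif_pos h, findM j k hk h]
    omega
  · rw [hcol]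
    split_ifs with h
    · have hs := Nat.find_spec h
      rcases mem_union.1 hs with h1 | h1
      · have hge : J + 1 ≤ Nat.find h := by
          by_contra hlt
          exact disjoint_left.1 (hRU _ (by omega)) hk h1
        omega
      · exact absurd (hWmF _ h1) (disjoint_left.1 hRF hk)
    · rfl
  · rw [hcol]
    split_ifs with h
    · have hs := Nat.find_spec h
      rcases mem_union.1 hs with h1 | h1
      · exact absurd hk (disjoint_left.1 (hWpF _) h1)
      · have hge : J + 1 ≤ Nat.find h := by
          by_contra hlt
          exact hk' _ (by omega) h1
        omega
    · rfl

/-- **Theorem 28(f) (block data from windows).** [this work] -/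
theorem exists_blocks [Fintype α] (F : Finset α) (Wp Wm : ℕ → Finset α) (J : ℕ)
    (hWpF : ∀ j, Disjoint (Wp j) F) (hWmF : ∀ j, Wm j ⊆ F) (hcardW : ∀ j, #(Wp j) = #(Wm j))
    (hdisjP : ∀ j j', j ≠ j' → Disjoint (Wp j) (Wp j'))
    (hdisjM : ∀ j j', j ≠ j' → Disjoint (Wm j) (Wm j')) (h2n : 2 * #F ≤ Fintype.card α) :
    ∃ (A R C : Finset α) (col : α → ℕ), F ⊆ A ∧ #(A \ F) = #F ∧
      A \ F = (range (J + 1)).biUnion Wp ∪ R ∧ Disjoint ((range (J + 1)).biUnion Wp) R ∧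
      F = (range (J + 1)).biUnion Wm ∪ C ∧ Disjoint ((range (J + 1)).biUnion Wm) C ∧ #R = #C ∧
      (∀ c, #((A \ F).filter fun k => col k = c) = #(F.filter fun k => col k = c)) ∧
      (∀ j < J + 1, ∀ k ∈ Wp j, col k = j) ∧ (∀ j < J + 1, ∀ k ∈ Wm j, col k = j) ∧
      (∀ k ∈ R, col k = J + 1) ∧ (∀ k ∈ C, col k = J + 1) := by
  classical
  set Up := (range (J + 1)).biUnion Wp with hUp
  set Um := (range (J + 1)).biUnion Wm with hUm
  have hUpF : Disjoint Up F := (disjoint_biUnion_left _ _ _).2 fun j _ => hWpF j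
  have hUmF : Um ⊆ F := biUnion_subset.2 fun j _ => hWmF j
  have hcUp : #Up = ∑ j ∈ range (J + 1), #(Wp j) :=
    card_biUnion fun i _ j _ hij => hdisjP i j hij
  have hcUm : #Um = ∑ j ∈ range (J + 1), #(Wm j) :=
    card_biUnion fun i _ j _ hij => hdisjM i j hij
  have hcU : #Up = #Um := by rw [hcUp, hcUm]; exact sum_congr rfl fun j _ => hcardW j
  -- the core `C = F \ Um` and the far set `R`
  have hC : #(F \ Um) + #Um = #F := card_sdiff_add_card_eq_card hUmF
  have hUmle : #Um ≤ #F := card_le_card hUmF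
  have hout : #(univ \ (F ∪ Up)) + #(F ∪ Up) = Fintype.card α := by
    rw [card_sdiff_add_card_eq_card (subset_univ _), card_univ]
  have hFU : #(F ∪ Up) = #F + #Up := card_union_of_disjoint hUpF.symm
  obtain ⟨R, hRsub, hRcard⟩ := exists_subset_card_eq (s := univ \ (F ∪ Up)) (n := #(F \ Um))
    (by omega)
  have hRF : Disjoint R F := by
    refine disjoint_left.2 fun k hk hkF => ?_
    have := (mem_sdiff.1 (hRsub hk)).2
    exact this (mem_union_left _ hkF)
  have hRUp : Disjoint Up R := by
    refine disjoint_left.2 fun k hk hkR => ?_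
    have := (mem_sdiff.1 (hRsub hkR)).2
    exact this (mem_union_right _ hk)
  have hRU : ∀ j < J + 1, Disjoint R (Wp j) := fun j hj =>
    disjoint_left.2 fun k hkR hk =>
      disjoint_left.1 hRUp (mem_biUnion.2 ⟨j, mem_range.2 hj, hk⟩) hkR
  obtain ⟨col, hcolP, hcolM, hcolR, hcolF⟩ :=
    exists_col F R Wp Wm J hWpF hWmF hdisjP hdisjM hRF hRU
  have hcolC : ∀ k ∈ F \ Um, col k = J + 1 := fun k hk =>
    hcolF k (mem_sdiff.1 hk).1 fun j hj hkj =>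
      (mem_sdiff.1 hk).2 (mem_biUnion.2 ⟨j, mem_range.2 hj, hkj⟩)
  have hAF : (F ∪ (Up ∪ R)) \ F = Up ∪ R :=
    union_sdiff_cancel_left (disjoint_union_right.2 ⟨hUpF.symm, hRF.symm⟩)
  have hFeq : F = Um ∪ (F \ Um) := (union_sdiff_of_subset hUmF).symm
  refine ⟨F ∪ (Up ∪ R), R, F \ Um, col, subset_union_left, ?_, hAF, hRUp, hFeq, disjoint_sdiff,
    hRcard, fun c => ?_, hcolP, hcolM, hcolR, hcolC⟩
  · rw [hAF, card_union_of_disjoint hRUp, hRcard, hcU]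
    exact hC.symm ▸ (add_comm _ _).le.antisymm (by omega)
  · rw [hAF]
    exact card_filter_col_eq_of_pieces (Up ∪ R) F R (F \ Um) Wp Wm J col rfl hFeq hcolP hcolM
      hcolR hcolC (fun j _ => hcardW j) hRcard c

end Summit.HubbardSuperconductivity.HubbardSuperconductivity.Theorems.CooperBlocks
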